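import Summits.AtomisticToContinuum.HydrodynamicLimit.Theses.JParityClosure
import Summits.AtomisticToContinuum.HydrodynamicLimit.Theorems.EvenStressEnskog.Negative.PairFunctionalVanishing
import Summits.AtomisticToContinuum.HydrodynamicLimit.Theorems.EvenStressEnskog.Negative.FrequencyLawReduction

/-!
# `EvenStressEnskog` with the two limits swapped is (junk-)true

Negative knowledge for the crux `JParityClosure.EvenStressEnskog` (stmt-AtomisticToContinuum-13079), from the
standing disprover's `Cruxes/EvenStressEnskog/Disproof.lean` §9 (cycle 2). The crux takes `N → ∞` at fixed
mollification radius `r`, then `r → 0` (`∃ r₀ ∀ r < r₀ ∃ N₀ ∀ N ≥ N₀`). The statement obtained by SWAPPING the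
two limits (`∃ N₀ ∀ N ≥ N₀ ∃ r₀ ∀ r < r₀`, so that `r₀` may depend on `N`; everything else VERBATIM the route
decl) is PROVED below — for junk reasons: at fixed `N`, once `r` is small,

* the cutoff weight `g(σ³ρ_r(x_i))` read at a colliding particle vanishes for EVERY particle, because the
  mollified density at a particle contains that particle's own cone mass `3/(πr³(N+1))` ("self-smearing",
  `self_le_mollifiedDensity`), which exceeds the threshold `η₀/σ³` (`cutoff_self_eq_zero`); so the collision
  functional `K_N[χ g Ξ]` is `0` for every mark (`collisionFunctional_eq_zero_of_forall`);
* the Enskog pair functional `B_r` vanishes identically on the hard-sphere domain once `2r < ε_N`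
  (`pairFunctional_flow_eq_zero_of_two_r_lt`, `Negative/PairFunctionalVanishing.lean`).

Hence the deviation `Dm` is `0` on every good orbit (`deviation_eq_zero_of_small_r`) and the deviation event
is inside the Liouville-null bad set of the flow (`evenStressEnskog_swappedOrder`; `localGibbsLaw_compl_good` from
`Negative/FrequencyLawReduction.lean`). MORAL: the ORDER of the
two limits carries all the content of the crux; `r` must never depend on `N` (not even `r_N = ε_N/2`), and in
the honest order the self-term `3σ³/(πr³(N+1)) → 0` is what a prover absorbs before `r → 0`.
refuter-cdisprove-stmt-AtomisticToContinuum-13079-g2-0.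
-/

noncomputable section

namespace Summit.AtomisticToContinuum.HydrodynamicLimit.Theorems

open MeasureTheory Filter Set
open scoped ENNReal InnerProductSpace
open Literature.MathematicalPhysics.KineticTheory Literature.Analysis.FluidPDE

namespace EvenStressEnskog

/-- **Self-smearing floor.** The `r`-mollified empirical density read AT particle `i` contains that
particle's own cone mass: `3/(πr³(N+1)) ≤ ρ_r(x_i)`. [folklore] -/
theorem self_le_mollifiedDensity {N : ℕ} {r : ℝ} (hr : 0 < r) (z : Config (N + 1) (Fin 3) T3)
    (i : Fin (N + 1)) :
    3 / (Real.pi * r ^ 3) / (N + 1 : ℝ) ≤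
      ∫ q, 3 / (Real.pi * r ^ 3) * max (1 - Torus.euclidDist q.1 (z i).1 / r) 0 ∂(empiricalMeasure z) := by
  rw [integral_empiricalMeasure]
  have hself : 3 / (Real.pi * r ^ 3) * max (1 - Torus.euclidDist (z i).1 (z i).1 / r) 0 =
      3 / (Real.pi * r ^ 3) := by
    simp [Torus.euclidDist_self]
  have hsum : 3 / (Real.pi * r ^ 3) * max (1 - Torus.euclidDist (z i).1 (z i).1 / r) 0 ≤
      ∑ k, 3 / (Real.pi * r ^ 3) * max (1 - Torus.euclidDist (z k).1 (z i).1 / r) 0 :=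
    Finset.single_le_sum (fun k _ => coneMollifier_nonneg hr (z k).1 (z i).1) (Finset.mem_univ i)
  rw [hself] at hsum
  have hN : (0 : ℝ) < ((N + 1 : ℕ) : ℝ) := by positivity
  calc 3 / (Real.pi * r ^ 3) / (N + 1 : ℝ) = ((N + 1 : ℕ) : ℝ)⁻¹ * (3 / (Real.pi * r ^ 3)) := by
        push_cast; ring
    _ ≤ ((N + 1 : ℕ) : ℝ)⁻¹ * ∑ k, 3 / (Real.pi * r ^ 3) * max (1 - Torus.euclidDist (z k).1 (z i).1 / r) 0 :=
        mul_le_mul_of_nonneg_left hsum (inv_nonneg.mpr hN.le)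

/-- **Cutoff saturation by self-smearing.** If `r ≤ 1` and `r ≤ 3σ³/(π(N+1)η₀)` then `η₀ ≤ σ³ρ_r(x_i)`, so a
cutoff `g` vanishing on `[η₀, ∞)` kills the weight of EVERY particle of EVERY configuration. [folklore] -/
theorem cutoff_self_eq_zero {N : ℕ} {r σ η₀ : ℝ} (hr : 0 < r) (hr1 : r ≤ 1)
    (hrN : r ≤ 3 * σ ^ 3 / (Real.pi * (N + 1 : ℝ) * η₀)) (hσ : 0 < σ) (hη₀ : 0 < η₀)
    (g : ℝ → ℝ) (hg0 : ∀ a, η₀ ≤ a → g a = 0) (z : Config (N + 1) (Fin 3) T3) (i : Fin (N + 1)) :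
    g (σ ^ 3 * ∫ q, 3 / (Real.pi * r ^ 3) * max (1 - Torus.euclidDist q.1 (z i).1 / r) 0
      ∂(empiricalMeasure z)) = 0 := by
  apply hg0
  have h1 := self_le_mollifiedDensity hr z i
  have hN : (0 : ℝ) < (N + 1 : ℝ) := by positivity
  have hpos : 0 < Real.pi * (N + 1 : ℝ) * η₀ := by positivity
  have hA : r * (Real.pi * (N + 1 : ℝ) * η₀) ≤ 3 * σ ^ 3 := (le_div_iff₀ hpos).mp hrN
  have hr3 : r ^ 3 ≤ r := by
    have e : r ^ 3 = r * (r * r) := by ring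
    rw [e]
    refine mul_le_of_le_one_right hr.le ?_
    nlinarith
  have key : η₀ ≤ σ ^ 3 * (3 / (Real.pi * r ^ 3) / (N + 1 : ℝ)) := by
    have e : σ ^ 3 * (3 / (Real.pi * r ^ 3) / (N + 1 : ℝ)) =
        3 * σ ^ 3 / (Real.pi * r ^ 3 * (N + 1 : ℝ)) := by
      field_simp
    rw [e, le_div_iff₀ (by positivity)]
    calc η₀ * (Real.pi * r ^ 3 * (N + 1 : ℝ)) ≤ η₀ * (Real.pi * r * (N + 1 : ℝ)) := by
          apply mul_le_mul_of_nonneg_left _ hη₀.le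
          apply mul_le_mul_of_nonneg_right _ hN.le
          exact mul_le_mul_of_nonneg_left hr3 Real.pi_pos.le
      _ = r * (Real.pi * (N + 1 : ℝ) * η₀) := by ring
      _ ≤ 3 * σ ^ 3 := hA
  exact key.trans (mul_le_mul_of_nonneg_left h1 (pow_pos hσ 3).le)

/-- A collision functional `K_N[Fn] = ε/(N+1) Σ_{collision times ≤ τ} Σ_{ordered contact pairs} Fn` all of whose
weights vanish is `0` — for EVERY configuration and path family (a `finsum` of zeros is `0`; no finiteness of
the collision set is needed). [folklore] -/
theorem collisionFunctional_eq_zero_of_forall {N : ℕ} (ε τ : ℝ)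
    (γ : Config (N + 1) (Fin 3) T3 → ℝ → Config (N + 1) (Fin 3) T3)
    (Fn : Config (N + 1) (Fin 3) T3 → ℝ → Fin (N + 1) → Fin (N + 1) → ℝ)
    (z : Config (N + 1) (Fin 3) T3) (h : ∀ s i j, Fn z s i j = 0) :
    ε / (N + 1 : ℝ) * ∑ᶠ (s : ℝ) (_ : s ∈ collisionTimes (Torus.geometry (Fin 3)) ε (γ z) ∩ Set.Icc 0 τ),
      ∑ i : Fin (N + 1), ∑ j : Fin (N + 1),
        (if i ≠ j ∧ ‖(Torus.geometry (Fin 3)).sepVec (γ z s i).1 (γ z s j).1‖ = ε then Fn z s i j else 0)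
      = 0 := by
  have hs : ∀ s : ℝ, (∑ i : Fin (N + 1), ∑ j : Fin (N + 1),
      (if i ≠ j ∧ ‖(Torus.geometry (Fin 3)).sepVec (γ z s i).1 (γ z s j).1‖ = ε then Fn z s i j else 0))
        = 0 := by
    intro s
    refine Finset.sum_eq_zero fun i _ => Finset.sum_eq_zero fun j _ => ?_
    rw [h s i j]
    split_ifs <;> rfl
  simp_rw [hs]
  simp

/-- **Both sides of the crux vanish at small `r` for fixed `N`.** Once `r ≤ 1`, `2r < ε_N` and
`r ≤ 3σ³/(π(N+1)η₀)`: on every good orbit the cutoff kills every summand of `K_N` (at every time, for every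
mark `Ξ`, weight `χ`, horizon `τ`) and `B_r ≡ 0`, so the deviation random variable `Dm Ξ` of the crux (VERBATIM,
with an arbitrary contact-value function `Y`) is `0`. [folklore] -/
theorem deviation_eq_zero_of_small_r {N : ℕ} {σ η₀ r : ℝ} (hσ : 0 < σ) (hη₀ : 0 < η₀) (hr : 0 < r)
    (hr1 : r ≤ 1) (hrε : 2 * r < hsDiameter σ N) (hrN : r ≤ 3 * σ ^ 3 / (Real.pi * (N + 1 : ℝ) * η₀))
    (Φ : HardSphereFlow (Torus.geometry (Fin 3)) (hsDiameter σ N) (N + 1)) (τ : ℝ) (χ : ℝ × T3 → ℝ)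
    (g : ℝ → ℝ) (hg0 : ∀ a, η₀ ≤ a → g a = 0) (Y : ℝ → ℝ) (Ξ : V3 × V3 × V3 → ℝ)
    {z : Config (N + 1) (Fin 3) T3} (hz : z ∈ Φ.good) :
    hsDiameter σ N / (N + 1 : ℝ) *
        ∑ᶠ (s : ℝ) (_ : s ∈ collisionTimes (Torus.geometry (Fin 3)) (hsDiameter σ N) (fun s => Φ.flow s z) ∩
            Set.Icc 0 τ),
          ∑ i : Fin (N + 1), ∑ j : Fin (N + 1),
            (if i ≠ j ∧ ‖(Torus.geometry (Fin 3)).sepVec (Φ.flow s z i).1 (Φ.flow s z j).1‖ = hsDiameter σ N then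
              χ (s, (Φ.flow s z i).1) *
                g (σ ^ 3 * ∫ q, 3 / (Real.pi * r ^ 3) * max (1 - Torus.euclidDist q.1 (Φ.flow s z i).1 / r) 0
                  ∂(empiricalMeasure (Φ.flow s z))) *
                Ξ ((hsDiameter σ N)⁻¹ • (Torus.geometry (Fin 3)).sepVec (Φ.flow s z i).1 (Φ.flow s z j).1,
                  (reflectVel ((Torus.geometry (Fin 3)).sepVec (Φ.flow s z i).1 (Φ.flow s z j).1)
                    ((Φ.flow s z i).2, (Φ.flow s z j).2)).1,
                  (reflectVel ((Torus.geometry (Fin 3)).sepVec (Φ.flow s z i).1 (Φ.flow s z j).1)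
                    ((Φ.flow s z i).2, (Φ.flow s z j).2)).2)
             else 0) -
      σ ^ 3 * ∫ s in Set.Icc (0 : ℝ) τ, ∫ x : T3,
        χ (s, x) *
          g (σ ^ 3 * ∫ q, 3 / (Real.pi * r ^ 3) * max (1 - Torus.euclidDist q.1 x / r) 0
            ∂(empiricalMeasure (Φ.flow s z))) *
          Y (σ ^ 3 * ∫ q, 3 / (Real.pi * r ^ 3) * max (1 - Torus.euclidDist q.1 x / r) 0
            ∂(empiricalMeasure (Φ.flow s z))) *
          ∫ p, 3 / (Real.pi * r ^ 3) * max (1 - Torus.euclidDist p.1.1 x / r) 0 *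
              (3 / (Real.pi * r ^ 3) * max (1 - Torus.euclidDist p.2.1 x / r) 0) *
              ∫ ω : Metric.sphere (0 : V3) 1, Ξ ((ω : V3), p.1.2, p.2.2) * hardSphereKernel (p.2.2, p.1.2) ω
                ∂sphereMeasure
            ∂((empiricalMeasure (Φ.flow s z)).prod (empiricalMeasure (Φ.flow s z))) = 0 := by
  have hK : hsDiameter σ N / (N + 1 : ℝ) *
        ∑ᶠ (s : ℝ) (_ : s ∈ collisionTimes (Torus.geometry (Fin 3)) (hsDiameter σ N) (fun s => Φ.flow s z) ∩
            Set.Icc 0 τ),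
          ∑ i : Fin (N + 1), ∑ j : Fin (N + 1),
            (if i ≠ j ∧ ‖(Torus.geometry (Fin 3)).sepVec (Φ.flow s z i).1 (Φ.flow s z j).1‖ = hsDiameter σ N then
              χ (s, (Φ.flow s z i).1) *
                g (σ ^ 3 * ∫ q, 3 / (Real.pi * r ^ 3) * max (1 - Torus.euclidDist q.1 (Φ.flow s z i).1 / r) 0
                  ∂(empiricalMeasure (Φ.flow s z))) *
                Ξ ((hsDiameter σ N)⁻¹ • (Torus.geometry (Fin 3)).sepVec (Φ.flow s z i).1 (Φ.flow s z j).1,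
                  (reflectVel ((Torus.geometry (Fin 3)).sepVec (Φ.flow s z i).1 (Φ.flow s z j).1)
                    ((Φ.flow s z i).2, (Φ.flow s z j).2)).1,
                  (reflectVel ((Torus.geometry (Fin 3)).sepVec (Φ.flow s z i).1 (Φ.flow s z j).1)
                    ((Φ.flow s z i).2, (Φ.flow s z j).2)).2)
             else 0) = 0 := by
    exact collisionFunctional_eq_zero_of_forall (hsDiameter σ N) τ (fun z s => Φ.flow s z)
      (fun z s i j => χ (s, (Φ.flow s z i).1) *
        g (σ ^ 3 * ∫ q, 3 / (Real.pi * r ^ 3) * max (1 - Torus.euclidDist q.1 (Φ.flow s z i).1 / r) 0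
          ∂(empiricalMeasure (Φ.flow s z))) *
        Ξ ((hsDiameter σ N)⁻¹ • (Torus.geometry (Fin 3)).sepVec (Φ.flow s z i).1 (Φ.flow s z j).1,
          (reflectVel ((Torus.geometry (Fin 3)).sepVec (Φ.flow s z i).1 (Φ.flow s z j).1)
            ((Φ.flow s z i).2, (Φ.flow s z j).2)).1,
          (reflectVel ((Torus.geometry (Fin 3)).sepVec (Φ.flow s z i).1 (Φ.flow s z j).1)
            ((Φ.flow s z i).2, (Φ.flow s z j).2)).2)) z
      (fun s i j => by
        rw [cutoff_self_eq_zero hr hr1 hrN hσ hη₀ g hg0 (Φ.flow s z) i]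
        ring)
  have hB : ∀ (s : ℝ) (x : T3),
      ∫ p, 3 / (Real.pi * r ^ 3) * max (1 - Torus.euclidDist p.1.1 x / r) 0 *
          (3 / (Real.pi * r ^ 3) * max (1 - Torus.euclidDist p.2.1 x / r) 0) *
          ∫ ω : Metric.sphere (0 : V3) 1, Ξ ((ω : V3), p.1.2, p.2.2) * hardSphereKernel (p.2.2, p.1.2) ω
            ∂sphereMeasure
        ∂((empiricalMeasure (Φ.flow s z)).prod (empiricalMeasure (Φ.flow s z))) = 0 := fun s x =>
    pairFunctional_flow_eq_zero_of_two_r_lt hr hrε Φ hz s Ξ x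
  simp_rw [hB]
  rw [hK]
  simp

/-- **`EvenStressEnskog` with the limit order SWAPPED is (junk-)true.** The type below is VERBATIM the route decl
`JParityClosure.EvenStressEnskog` except that `∃ r₀, 0 < r₀ ∧ ∀ r, 0 < r → r < r₀ → ∃ N₀, ∀ N, N₀ ≤ N →` is
replaced by `∃ N₀, ∀ N, N₀ ≤ N → ∃ r₀, 0 < r₀ ∧ ∀ r, 0 < r → r < r₀ →` (`r → 0` BEFORE `N → ∞`). Witnesses:
`η₀ := 1`, `σ₀ := 1`, `N₀ := 0`, `r₀(N) := min (min 1 (ε_N/2)) (3σ³/(π(N+1)))`; the deviation event lies in the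
Liouville-null bad set. So a would-be proof of the crux that is insensitive to the order of the two limits
proves nothing. [folklore] -/
theorem evenStressEnskog_swappedOrder :
    ∃ η₀ : ℝ, 0 < η₀ ∧ ∀ (a₀ θ₀ : Literature.MathematicalPhysics.KineticTheory.T3 → ℝ) (u₀ : Literature.MathematicalPhysics.KineticTheory.T3 → Literature.MathematicalPhysics.KineticTheory.V3), Continuous a₀ → Continuous θ₀ → Continuous u₀ → (∀ x, 0 < a₀ x) → (∀ x, 0 < θ₀ x) → ∃ σ₀ : ℝ, 0 < σ₀ ∧ ∀ σ : ℝ, 0 < σ → σ < σ₀ → ∀ Φ : (N : ℕ) → Literature.Analysis.FluidPDE.HardSphereFlow (Literature.Analysis.FluidPDE.Torus.geometry (Fin 3)) (Literature.MathematicalPhysics.KineticTheory.hsDiameter σ N) (N + 1), ∀ τ : ℝ, 0 < τ → ∀ χ : ℝ × UnitAddTorus (Fin 3) → ℝ, Continuous χ → ∀ g : ℝ → ℝ, Continuous g → (∀ a, η₀ ≤ a → g a = 0) → ∀ η δ : ℝ, 0 < η → 0 < δ → ∃ N₀ : ℕ, ∀ N : ℕ, N₀ ≤ N → ∃ r₀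 : ℝ, 0 < r₀ ∧ ∀ r : ℝ, 0 < r → r < r₀ → let ε := Literature.MathematicalPhysics.KineticTheory.hsDiameter σ N; let G := Literature.Analysis.FluidPDE.Torus.geometry (Fin 3); let γ := fun z (s : ℝ) => (Φ N).flow s z; let bx : UnitAddTorus (Fin 3) → UnitAddTorus (Fin 3) → ℝ := fun x y => 3 / (Real.pi * r ^ 3) * max (1 - Literature.Analysis.FluidPDE.Torus.euclidDist x y / r) 0; let ρm := fun z s (x₀ : UnitAddTorus (Fin 3)) => ∫ q, bx q.1 x₀ ∂(Literature.Analysis.FluidPDE.empiricalMeasure (γ z s)); let Θ := fun (Ξ : EuclideanSpace ℝ (Fin 3) × EuclideanSpace ℝ (Fin 3) × EuclideanSpace ℝ (Fin 3) → ℝ) (v w : EuclideanSpace ℝ (Fin 3)) => ∫ ω : Metric.sphere (0 : EuclideanSpace ℝ (Fin 3)) 1, Ξ ((ω : EuclideanSpace ℝ (Fin 3)), v, w) * Literature.MathematicalPhysics.KineticTheory.hardSphereKernel (w, v) ω ∂Literature.MathematicalPhysics.KineticTheory.sphereMeasure; let B := fun Ξ z s (x₀ : UnitAddTorus (Fin 3))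 => ∫ p, bx p.1.1 x₀ * bx p.2.1 x₀ * Θ Ξ p.1.2 p.2.2 ∂((Literature.Analysis.FluidPDE.empiricalMeasure (γ z s)).prod (Literature.Analysis.FluidPDE.empiricalMeasure (γ z s))); let pv := fun z s (i j : Fin (N + 1)) => Literature.Analysis.FluidPDE.reflectVel (G.sepVec (γ z s i).1 (γ z s j).1) ((γ z s i).2, (γ z s j).2); let Kc := fun (Fn : Literature.Analysis.FluidPDE.Config (N + 1) (Fin 3) Literature.MathematicalPhysics.KineticTheory.T3 → ℝ → Fin (N + 1) → Fin (N + 1) → ℝ) z => ε / (N + 1 : ℝ) * ∑ᶠ (s : ℝ) (_ : s ∈ Literature.Analysis.FluidPDE.collisionTimes G ε (γ z) ∩ Set.Icc 0 τ), ∑ i : Fin (N + 1), ∑ j : Fin (N + 1), (if i ≠ j ∧ ‖G.sepVec (γ z s i).1 (γ z s j).1‖ = ε then Fn z s i j else 0); let Y : ℝ → ℝ := fun a => 3 / (2 * Real.pi) * deriv Literature.MathematicalPhysics.KineticTheory.hsExcessFreeEnergy a; let Dm := fun (Ξ : EuclideanSpace ℝ (Fin 3) × EuclideanSpace ℝ (Fin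 3) × EuclideanSpace ℝ (Fin 3) → ℝ) z => Kc (fun z s i j => χ (s, (γ z s i).1) * g (σ ^ 3 * ρm z s (γ z s i).1) * Ξ (ε⁻¹ • G.sepVec (γ z s i).1 (γ z s j).1, (pv z s i j).1, (pv z s i j).2)) z - σ ^ 3 * ∫ s in Set.Icc (0 : ℝ) τ, ∫ x : UnitAddTorus (Fin 3), χ (s, x) * g (σ ^ 3 * ρm z s x) * Y (σ ^ 3 * ρm z s x) * B Ξ z s x; let ΞP := fun (k l : Fin 3) (q : EuclideanSpace ℝ (Fin 3) × EuclideanSpace ℝ (Fin 3) × EuclideanSpace ℝ (Fin 3)) => max ⟪q.2.2 - q.2.1, q.1⟫_ℝ 0 * (q.1 k * q.1 l); ∀ k l : Fin 3, Literature.MathematicalPhysics.KineticTheory.localGibbsLaw σ a₀ u₀ θ₀ N (Φ N) {z | η < |Dm (ΞP k l) z|} ≤ ENNReal.ofReal δ := by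
  refine ⟨1, one_pos, fun a₀ θ₀ u₀ _ _ _ _ _ => ⟨1, one_pos, ?_⟩⟩
  intro σ hσ _ Φ τ _ χ _ g _ hg0 η δ hη _
  refine ⟨0, fun N _ => ?_⟩
  have hεpos : 0 < hsDiameter σ N := hsDiameter_pos hσ N
  have hq : 0 < 3 * σ ^ 3 / (Real.pi * (N + 1 : ℝ) * 1) := by positivity
  refine ⟨min (min 1 (hsDiameter σ N / 2)) (3 * σ ^ 3 / (Real.pi * (N + 1 : ℝ) * 1)),
    lt_min (lt_min one_pos (half_pos hεpos)) hq, fun r hr hrlt => ?_⟩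
  intro ε G γ bx ρm Θ B pv Kc Y Dm ΞP k l
  have hr1 : r ≤ 1 := (hrlt.le.trans (min_le_left _ _)).trans (min_le_left _ _)
  have hrε : 2 * r < hsDiameter σ N := by
    have := (hrlt.trans_le (min_le_left _ _)).trans_le (min_le_right _ _)
    linarith
  have hrN : r ≤ 3 * σ ^ 3 / (Real.pi * (N + 1 : ℝ) * 1) := hrlt.le.trans (min_le_right _ _)
  have hzero : ∀ z ∈ (Φ N).good, Dm (ΞP k l) z = 0 := fun z hz =>
    deviation_eq_zero_of_small_r hσ one_pos hr hr1 hrε hrN (Φ N) τ χ g hg0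
      (fun a => 3 / (2 * Real.pi) * deriv hsExcessFreeEnergy a)
      (fun q => max ⟪q.2.2 - q.2.1, q.1⟫_ℝ 0 * (q.1 k * q.1 l)) hz
  calc localGibbsLaw σ a₀ u₀ θ₀ N (Φ N) {z | η < |Dm (ΞP k l) z|}
      ≤ localGibbsLaw σ a₀ u₀ θ₀ N (Φ N) (Φ N).goodᶜ := by
        refine measure_mono fun z hz' hzg => ?_
        have h0 := hzero z hzg
        simp only [Set.mem_setOf_eq] at hz'
        rw [h0, abs_zero] at hz'
        exact absurd hz' (not_lt.mpr hη.le)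
    _ = 0 := localGibbsLaw_compl_good (Φ N)
    _ ≤ ENNReal.ofReal δ := zero_le

end EvenStressEnskog

end Summit.AtomisticToContinuum.HydrodynamicLimit.Theorems

end
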